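import Summits.SmoothPoincare4.SmoothPoincare4.Theorems.ConvexBisectionAcyclicBisectionExistsOrseamPageFrame
import HarnessLib

/-!
# Dual handles, ORSEAM coupling: the orientation character of a fibred linear map is the sign of its
# page determinant
(sub-goal ORSEAM of stub `stub_T3_dualPresentation` (T3), line `modp-braid-orbits` r12, crux
`ConvexBisection.AcyclicBisectionExists`, item stmt-SmoothPoincare4-10508; wave 5, lead c5, worker X4;
registered sub-goal `helper_det4_sign_of_pageMap`)

Sequel of `…OrseamPageFrame.lean` (`det4 (∇rho, T, iT, n) > 0` for the page frames).  THE COUPLING LEMMA of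
the SIGN-PIN/ORSEAM node: ONE orientation character governs the page-twisting sign of the dual presentation
(ST4's global sign `s₀`, the sign of a PAGE determinant `⟪Λ(iT), iΛT⟫` of the differential `Λ` of the seam map,
worker X3) and the ORSEAM frame sign (`det4 (∇rho, Λ v₀, Λ v₁, Λ v₂)`, `…OrseamSignPin.lean`).  For a linear map
`Λ : ℝ⁴ → ℝ⁴` between two flat page points `q`, `q'` which is "the differential of a fibred map" — injective, tangent
vectors to tangent vectors, page line `L_q = ker dΦ_q` into `L_{q'}`, and the horizontal-normal component scaled by
ONE `κ > 0` (exactly the exports (i), (ii) of X3's `helper_ambDeriv_fibred` and `fderiv_rho_ambDeriv` for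
`Λ = ambDeriv g f x`) — and every positive tangent frame `V` at `q`:
**`sign det4 (∇rho (q'), ΛV₀, ΛV₁, ΛV₂) = sign ⟪Λ(iT), iΛT⟫`** (`det4_sign_of_pageMap`; with `T := pageVec g q`
the right-hand side is X3's `pageDet g Λ q`).  Proof: expand `V` in the positive frame `(T, iT, n)` (coefficient
matrix of positive determinant, `det4_lincomb₃`), `Λ(iT) = αT' + βiT'` in the complex line `L_{q'}`
(`exists_combo_of_pageTangent`, `β ‖T'‖² = ⟪Λ(iT), iT'⟫`), `Λ n = aT' + biT' + γ n'` with
`γ = κ ‖n‖²/‖n'‖² > 0`, and `det4 (N', T', αT' + βiT', aT' + biT' + γn') = βγ det4 (N', T', iT', n') `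
(`det4_triangular`) with `det4 (N', T', iT', n') > 0` (`det4_pageFrame_pos`).

Everything is proved; no named facts, no `sorry`.

## References
* R. İ. Baykur, *Kähler decomposition of 4-manifolds*, AGT 6 (2006), §2.3, proof of Thm. 5.1 p. 13. [Baykur2006]
* J. B. Etnyre, T. Fuller, *Realizing 4-manifolds as achiral Lefschetz fibrations*, IMRN 2006, Thm. 1 (proof, p. 8). [EtnyreFuller2006]
-/

noncomputable section

-- the prescribed namespace `Summit.<P>.<Sub>.…` duplicates `SmoothPoincare4` (P = Sub)
set_option linter.dupNamespace false

open scoped Manifold ContDiff Topology RealInnerProductSpace ComplexConjugate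

namespace Summit.SmoothPoincare4.SmoothPoincare4.Theorems.AcyclicBisectionExists.ModpBraidOrbits

open Set Function Metric Module Complex
open Literature.Topology.FourManifolds Literature.Topology.FourManifolds.HandleAttachingMap
  Literature.Topology.FourManifolds.LefschetzBase Literature.Geometry.Symplectic

variable {g : ℕ}

/-! ## §1 Complex lines and the complex rotate -/

/-- `⟪v, iv⟫ = 0`. [folklore] -/
theorem inner_self_cplxJ (v : EuclideanSpace ℝ (Fin 4)) : ⟪v, cplxJ v⟫ = 0 := by
  rw [inner_cplxJ, Complex.mul_conj, Complex.mul_conj]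
  simp

/-- `‖iv‖² = ‖v‖²` (as `⟪iv, iv⟫ = ‖v‖²`). [folklore] -/
theorem inner_cplxJ_cplxJ_self (v : EuclideanSpace ℝ (Fin 4)) : ⟪cplxJ v, cplxJ v⟫ = ‖v‖ ^ 2 := by
  rw [inner_eq_re_herm, cx_cplxJ, cy_cplxJ, norm_sq_eq, Complex.sq_norm, Complex.sq_norm]
  simp only [map_mul, Complex.conj_I, Complex.add_re, Complex.mul_re, Complex.mul_im, Complex.neg_re,
    Complex.neg_im, Complex.I_re, Complex.I_im, Complex.conj_re, Complex.conj_im, Complex.normSq_apply]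
  ring

/-- **Two page tangents at the same point are complex-proportional**: for `q ≠ 0`, `T ≠ 0` and `Y` in the
complex line `L_q = ker dΦ_q`, `Y = α T + β iT` for real `α, β`. [folklore] -/
theorem exists_combo_of_pageTangent {q T Y : EuclideanSpace ℝ (Fin 4)} (hq : q ≠ 0) (hT0 : T ≠ 0)
    (hT : dPhiX g q * cx T + dPhiY q * cy T = 0) (hY : dPhiX g q * cx Y + dPhiY q * cy Y = 0) :
    ∃ α β : ℝ, Y = α • T + β • cplxJ T := by
  -- a complex factor `μ` with `(cx Y, cy Y) = μ (cx T, cy T)`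
  have hμ : ∃ μ : ℂ, cx Y = μ * cx T ∧ cy Y = μ * cy T := by
    have hTne : cx T ≠ 0 ∨ cy T ≠ 0 := by
      by_contra h
      push Not at h
      apply hT0
      rw [← mk_cx_cy T, h.1, h.2]
      apply ext_cx_cy <;> simp
    rcases dPhiX_ne_zero_or (g := g) hq with ha | hb
    · -- `a ≠ 0`: `x = -(b/a) y`, so `y ≠ 0`
      have hxT : cx T = -(dPhiY q / dPhiX g q) * cy T := by field_simp; linear_combination hT
      have hxY : cx Y = -(dPhiY q / dPhiX g q) * cy Y := by field_simp; linear_combination hY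
      have hy : cy T ≠ 0 := by
        rcases hTne with h | h
        · intro h0; apply h; rw [hxT, h0, mul_zero]
        · exact h
      refine ⟨cy Y / cy T, ?_, by field_simp⟩
      rw [hxY, hxT]; field_simp
    · have hyT : cy T = -(dPhiX g q / dPhiY q) * cx T := by field_simp; linear_combination hT
      have hyY : cy Y = -(dPhiX g q / dPhiY q) * cx Y := by field_simp; linear_combination hY
      have hx : cx T ≠ 0 := by
        rcases hTne with h | h
        · exact h
        · intro h0; apply h; rw [hyT, h0, mul_zero]
      refine ⟨cx Y / cx T, by field_simp, ?_⟩
      rw [hyY, hyT]; field_simp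
  obtain ⟨μ, hx, hy⟩ := hμ
  refine ⟨μ.re, μ.im, ext_cx_cy ?_ ?_⟩
  · rw [cx_add, cx_smul, cx_smul, cx_cplxJ, hx]
    conv_lhs => rw [← Complex.re_add_im μ]
    ring
  · rw [cy_add, cy_smul, cy_smul, cy_cplxJ, hy]
    conv_lhs => rw [← Complex.re_add_im μ]
    ring

/-- `iT` is never a REAL multiple of `T ≠ 0`. [folklore] -/
theorem cplxJ_ne_smul {T : EuclideanSpace ℝ (Fin 4)} (hT0 : T ≠ 0) (α : ℝ) : cplxJ T ≠ α • T := by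
  intro h
  have hx := congrArg cx h
  have hy := congrArg cy h
  rw [cx_cplxJ, cx_smul] at hx
  rw [cy_cplxJ, cy_smul] at hy
  have hTne : cx T ≠ 0 ∨ cy T ≠ 0 := by
    by_contra h'
    push Not at h'
    apply hT0
    rw [← mk_cx_cy T, h'.1, h'.2]
    apply ext_cx_cy <;> simp
  have hI : Complex.I = (α : ℂ) := by
    rcases hTne with h' | h'
    · exact mul_right_cancel₀ h' hx
    · exact mul_right_cancel₀ h' hy
  have := congrArg Complex.im hI
  simp at this

/-! ## §2 Expansion in a positive frame -/

/-- **Tangent vectors expand in the frame `(T, U, M)`**: if `det4 (N, T, U, M) ≠ 0`, `T, U, M ⊥ N` and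
`X ⊥ N`, then `X = x₁ T + x₂ U + x₃ M`. [folklore] -/
theorem exists_coeffs_of_tangent {N T U M X : EuclideanSpace ℝ (Fin 4)} (hD : det4 N T U M ≠ 0)
    (hT : ⟪N, T⟫ = 0) (hU : ⟪N, U⟫ = 0) (hM : ⟪N, M⟫ = 0) (hX : ⟪N, X⟫ = 0) :
    ∃ x₁ x₂ x₃ : ℝ, X = x₁ • T + x₂ • U + x₃ • M := by
  have hspan := span_eq_top_of_det4_ne_zero hD
  obtain ⟨c, hc⟩ : ∃ c : Fin 4 → ℝ, ∑ i, c i • ![N, T, U, M] i = X :=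
    (Submodule.mem_span_range_iff_exists_fun ℝ).1 (by rw [hspan]; exact Submodule.mem_top)
  have hN : N ≠ 0 := by
    intro h0; apply hD; rw [h0, ← zero_smul ℝ (0 : EuclideanSpace ℝ (Fin 4)), det4_smul_left, zero_mul]
  have hc0 : c 0 = 0 := by
    have := congrArg (fun v => ⟪N, v⟫) hc
    simp only [Fin.sum_univ_four, Matrix.cons_val_zero, Matrix.cons_val_one, Matrix.cons_val, inner_add_right,
      real_inner_smul_right, hT, hU, hM, hX, mul_zero, add_zero, real_inner_self_eq_norm_sq] at this
    rcases mul_eq_zero.1 this with h | h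
    · exact h
    · exact absurd (pow_eq_zero_iff two_ne_zero |>.1 h) (norm_ne_zero_iff.2 hN)
  refine ⟨c 1, c 2, c 3, ?_⟩
  rw [← hc, Fin.sum_univ_four]
  simp only [Matrix.cons_val_zero, Matrix.cons_val_one, Matrix.cons_val, hc0, zero_smul, zero_add]

/-! ## §3 The coupling: orientation character = sign of the page determinant -/

/-- **The orientation character of a fibred linear map is the sign of its page determinant.**  Let `q`, `q'`
be flat points (`‖x‖² < 4`) off the origin with `w ≠ 0`, and `Λ : ℝ⁴ → ℝ⁴` linear, injective, mapping vectors
tangent to `{rho = rho q}` at `q` to vectors tangent at `q'`, the page line `ker dΦ_q` into `ker dΦ_{q'}`, and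
scaling the horizontal-normal component by one `κ > 0` (`⟪Λ X, n(q')⟫ = κ ⟪X, n(q)⟫` for tangent `X`).  Then for
every non-zero page tangent `T` at `q` and every tangent frame `V` at `q` with `det4 (∇rho (q), V) > 0`:
`0 < ⟪Λ(iT), iΛT⟫ · det4 (∇rho (q'), ΛV₀, ΛV₁, ΛV₂)`.  (With `T = pageVec g q` the first factor is the page
determinant `pageDet g Λ q`; for `Λ = ambDeriv g f x` of a `rho`-preserving, `w`-direction-preserving map `f` the
hypotheses are `helper_ambDeriv_fibred`.)  ONE orientation character: the page-orientation character (twisting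
sign, ST4) equals the `det4`-orientation character (ORSEAM frame sign). [cite: Baykur2006, §2.3] -/
theorem det4_sign_of_pageMap {q q' : EuclideanSpace ℝ (Fin 4)} (hq : q ≠ 0) (hq' : q' ≠ 0)
    (hflat : ‖cx q‖ ^ 2 < 4) (hflat' : ‖cx q'‖ ^ 2 < 4) (hw : w g q ≠ 0) (hw' : w g q' ≠ 0)
    (Λ : EuclideanSpace ℝ (Fin 4) →L[ℝ] EuclideanSpace ℝ (Fin 4)) (hΛ : Injective Λ)
    (hρ : ∀ X, fderiv ℝ (rho g) q X = 0 → fderiv ℝ (rho g) q' (Λ X) = 0)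
    (κ : ℝ) (hκ : 0 < κ)
    (hn : ∀ X, fderiv ℝ (rho g) q X = 0 → ⟪Λ X, horizNormal g q'⟫ = κ * ⟪X, horizNormal g q⟫)
    (hL : ∀ X, dPhiX g q * cx X + dPhiY q * cy X = 0 → dPhiX g q' * cx (Λ X) + dPhiY q' * cy (Λ X) = 0)
    (T : EuclideanSpace ℝ (Fin 4)) (hT0 : T ≠ 0) (hT : dPhiX g q * cx T + dPhiY q * cy T = 0)
    (V : Fin 3 → EuclideanSpace ℝ (Fin 4)) (hV : ∀ k, fderiv ℝ (rho g) q (V k) = 0)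
    (hpos : 0 < det4 (gradient (rho g) q) (V 0) (V 1) (V 2)) :
    0 < ⟪Λ (cplxJ T), cplxJ (Λ T)⟫ * det4 (gradient (rho g) q') (Λ (V 0)) (Λ (V 1)) (Λ (V 2)) := by
  -- the two page frames
  have hiT : dPhiX g q * cx (cplxJ T) + dPhiY q * cy (cplxJ T) = 0 := dPhi_cplxJ_pageTangent hT
  have hT'0 : Λ T ≠ 0 := fun h => hT0 (hΛ (by rw [h, map_zero]))
  have hT' : dPhiX g q' * cx (Λ T) + dPhiY q' * cy (Λ T) = 0 := hL T hT
  have hiT' : dPhiX g q' * cx (cplxJ (Λ T)) + dPhiY q' * cy (cplxJ (Λ T)) = 0 := dPhi_cplxJ_pageTangent hT'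
  have hB : 0 < det4 (gradient (rho g) q) T (cplxJ T) (horizNormal g q) := det4_pageFrame_pos hq hflat hw hT0 hT
  have hB' : 0 < det4 (gradient (rho g) q') (Λ T) (cplxJ (Λ T)) (horizNormal g q') :=
    det4_pageFrame_pos hq' hflat' hw' hT'0 hT'
  -- tangency (in the `fderiv` and in the `⟪∇rho, ·⟫` forms)
  have ρT : fderiv ℝ (rho g) q T = 0 := fderiv_rho_pageTangent hflat hT
  have ρiT : fderiv ℝ (rho g) q (cplxJ T) = 0 := fderiv_rho_pageTangent hflat hiT
  have ρn : fderiv ℝ (rho g) q (horizNormal g q) = 0 := fderiv_rho_horizNormal hq hflat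
  have ρT' : fderiv ℝ (rho g) q' (Λ T) = 0 := fderiv_rho_pageTangent hflat' hT'
  have ρiT' : fderiv ℝ (rho g) q' (cplxJ (Λ T)) = 0 := fderiv_rho_pageTangent hflat' hiT'
  have ρn' : fderiv ℝ (rho g) q' (horizNormal g q') = 0 := fderiv_rho_horizNormal hq' hflat'
  have tg : ∀ {p X : EuclideanSpace ℝ (Fin 4)}, fderiv ℝ (rho g) p X = 0 → ⟪gradient (rho g) p, X⟫ = 0 :=
    fun h => by rw [inner_gradient_eq_fderiv, h]
  -- expand `V` in the frame `(T, iT, n)`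
  have hcoef : ∀ k, ∃ x₁ x₂ x₃ : ℝ, V k = x₁ • T + x₂ • cplxJ T + x₃ • horizNormal g q := fun k =>
    exists_coeffs_of_tangent hB.ne' (tg ρT) (tg ρiT) (tg ρn) (tg (hV k))
  obtain ⟨x₁, x₂, x₃, hx⟩ := hcoef 0
  obtain ⟨y₁, y₂, y₃, hy⟩ := hcoef 1
  obtain ⟨z₁, z₂, z₃, hz⟩ := hcoef 2
  set dC : ℝ := x₁ * (y₂ * z₃ - y₃ * z₂) - x₂ * (y₁ * z₃ - y₃ * z₁) + x₃ * (y₁ * z₂ - y₂ * z₁) with hdC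
  have hside1 : det4 (gradient (rho g) q) (V 0) (V 1) (V 2) =
      dC * det4 (gradient (rho g) q) T (cplxJ T) (horizNormal g q) := by
    rw [hx, hy, hz, det4_lincomb₃]
  have hdCpos : 0 < dC := by
    have : 0 < dC * det4 (gradient (rho g) q) T (cplxJ T) (horizNormal g q) := by rw [← hside1]; exact hpos
    exact (mul_pos_iff_of_pos_right hB).1 this
  have hside2 : det4 (gradient (rho g) q') (Λ (V 0)) (Λ (V 1)) (Λ (V 2)) =
      dC * det4 (gradient (rho g) q') (Λ T) (Λ (cplxJ T)) (Λ (horizNormal g q)) := by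
    rw [hx, hy, hz]
    simp only [map_add, map_smul]
    rw [det4_lincomb₃]
  -- `Λ(iT) = α T' + β iT'` with `β ‖T'‖² = ⟪Λ(iT), iT'⟫`, `β ≠ 0`
  obtain ⟨α, β, hαβ⟩ := exists_combo_of_pageTangent hq' hT'0 hT' (hL _ hiT)
  have hβ : ⟪Λ (cplxJ T), cplxJ (Λ T)⟫ = β * ‖Λ T‖ ^ 2 := by
    rw [hαβ, inner_add_left, real_inner_smul_left, real_inner_smul_left, inner_self_cplxJ,
      inner_cplxJ_cplxJ_self, mul_zero, zero_add]
  have hβ0 : β ≠ 0 := by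
    intro h0
    rw [h0, zero_smul, add_zero, ← map_smul] at hαβ
    exact cplxJ_ne_smul hT0 α (hΛ hαβ)
  -- `Λ n = a T' + b iT' + γ n'` with `γ > 0`
  obtain ⟨a, b, γ, habγ⟩ := exists_coeffs_of_tangent hB'.ne' (tg ρT') (tg ρiT') (tg ρn') (tg (hρ _ ρn))
  have hnT' : ⟪Λ T, horizNormal g q'⟫ = 0 := by
    rw [inner_horizNormal, hT', mul_zero, Complex.zero_im, zero_div]
  have hniT' : ⟪cplxJ (Λ T), horizNormal g q'⟫ = 0 := by
    rw [inner_horizNormal, hiT', mul_zero, Complex.zero_im, zero_div]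
  have hn0 : horizNormal g q ≠ 0 := by
    intro h0; apply hB.ne'
    rw [h0, ← zero_smul ℝ (0 : EuclideanSpace ℝ (Fin 4)), det4_smul_last, zero_mul]
  have hn'0 : horizNormal g q' ≠ 0 := by
    intro h0; apply hB'.ne'
    rw [h0, ← zero_smul ℝ (0 : EuclideanSpace ℝ (Fin 4)), det4_smul_last, zero_mul]
  have hγ : γ * ‖horizNormal g q'‖ ^ 2 = κ * ‖horizNormal g q‖ ^ 2 := by
    have h1 := hn _ ρn
    rw [real_inner_self_eq_norm_sq, habγ, inner_add_left, inner_add_left, real_inner_smul_left,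
      real_inner_smul_left, real_inner_smul_left, hnT', hniT', real_inner_self_eq_norm_sq] at h1
    linarith
  have hγpos : 0 < γ := by
    have h1 : 0 < κ * ‖horizNormal g q‖ ^ 2 := mul_pos hκ (pow_pos (norm_pos_iff.2 hn0) 2)
    have h2 : 0 < ‖horizNormal g q'‖ ^ 2 := pow_pos (norm_pos_iff.2 hn'0) 2
    rw [← hγ] at h1
    exact (mul_pos_iff_of_pos_right h2).1 h1
  -- the triangular identity and the assembly
  have htri : det4 (gradient (rho g) q') (Λ T) (Λ (cplxJ T)) (Λ (horizNormal g q)) =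
      β * γ * det4 (gradient (rho g) q') (Λ T) (cplxJ (Λ T)) (horizNormal g q') := by
    rw [hαβ, habγ, det4_triangular]
  rw [hβ, hside2, htri]
  have h1 : 0 < ‖Λ T‖ ^ 2 := pow_pos (norm_pos_iff.2 hT'0) 2
  have h2 : 0 < β * β := mul_self_pos.2 hβ0
  have key : β * ‖Λ T‖ ^ 2 * (dC * (β * γ * det4 (gradient (rho g) q') (Λ T) (cplxJ (Λ T)) (horizNormal g q'))) =
      (β * β) * (‖Λ T‖ ^ 2 * (dC * (γ * det4 (gradient (rho g) q') (Λ T) (cplxJ (Λ T)) (horizNormal g q')))) := by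
    ring
  rw [key]
  positivity

/-! ## §4 The registered package -/

/-- **Sub-goal `helper_det4_sign_of_pageMap` of stub `stub_T3_dualPresentation`** (T3 ▸ SIGN-PIN/ORSEAM coupling;
wave 5, lead c5, worker X4): **the orientation character of a fibred linear map is the sign of its page
determinant** — for `Λ : ℝ⁴ → ℝ⁴` linear injective between flat page points `q`, `q'` (`‖x‖² < 4`, off the origin,
`w ≠ 0`) mapping tangent vectors to tangent vectors, the page line into the page line and scaling the
horizontal-normal component by one `κ > 0` (X3's `helper_ambDeriv_fibred` for `Λ = ambDeriv g f x`), a non-zero page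
tangent `T` and a positive tangent frame `V`: `0 < ⟪Λ(iT), iΛT⟫ · det4 (∇rho (q'), ΛV₀, ΛV₁, ΛV₂)` (with
`T = pageVec g q` the first factor is X3's `pageDet g Λ q`).  ONE orientation character governs the twisting sign
(ST4) and the ORSEAM frame sign. [cite: Baykur2006, §2.3] -/
theorem helper_det4_sign_of_pageMap : ∀ (g : ℕ) (q q' : EuclideanSpace ℝ (Fin 4)) (Λ : EuclideanSpace ℝ (Fin 4) →L[ℝ] EuclideanSpace ℝ (Fin 4)) (κ : ℝ) (T : EuclideanSpace ℝ (Fin 4)) (V : Fin 3 → EuclideanSpace ℝ (Fin 4)), q ≠ 0 → q' ≠ 0 → ‖Literature.Topology.FourManifolds.LefschetzBase.cx q‖ ^ 2 < 4 → ‖Literature.Topology.FourManifolds.LefschetzBase.cx q'‖ ^ 2 < 4 → Literature.Topology.FourManifolds.LefschetzBase.w g q ≠ 0 → Literature.Topology.FourManifolds.LefschetzBase.w g q' ≠ 0 → Function.Injective Λ → (∀ X, fderiv ℝ (Literature.Topology.FourManifolds.LefschetzBase.rho g) q X = 0 → fderiv ℝ (Literature.Topology.FourManifolds.LefschetzBase.rho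 g) q' (Λ X) = 0) → 0 < κ → (∀ X, fderiv ℝ (Literature.Topology.FourManifolds.LefschetzBase.rho g) q X = 0 → inner ℝ (Λ X) (Literature.Topology.FourManifolds.LefschetzBase.horizNormal g q') = κ * inner ℝ X (Literature.Topology.FourManifolds.LefschetzBase.horizNormal g q)) → (∀ X, Literature.Topology.FourManifolds.LefschetzBase.dPhiX g q * Literature.Topology.FourManifolds.LefschetzBase.cx X + Literature.Topology.FourManifolds.LefschetzBase.dPhiY q * Literature.Topology.FourManifolds.LefschetzBase.cy X = 0 → Literature.Topology.FourManifolds.LefschetzBase.dPhiX g q' * Literature.Topology.FourManifolds.LefschetzBase.cx (Λ X) + Literature.Topology.FourManifolds.LefschetzBase.dPhiY q' * Literature.Topology.FourManifolds.LefschetzBase.cy (Λ X) = 0) → T ≠ 0 → Literature.Topology.FourManifolds.LefschetzBase.dPhiX g q * Literature.Topology.FourManifolds.LefschetzBase.cx T + Literature.Topology.FourManifolds.LefschetzBase.dPhiY q * Literature.Topology.FourManifolds.LefschetzBase.cy T = 0 → (∀ k, fderiv ℝ (Literature.Topology.FourManifolds.LefschetzBase.rho g) q (V k) = 0) → 0 <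 Literature.Geometry.Symplectic.det4 (gradient (Literature.Topology.FourManifolds.LefschetzBase.rho g) q) (V 0) (V 1) (V 2) → 0 < inner ℝ (Λ (Literature.Topology.FourManifolds.LefschetzBase.cplxJ T)) (Literature.Topology.FourManifolds.LefschetzBase.cplxJ (Λ T)) * Literature.Geometry.Symplectic.det4 (gradient (Literature.Topology.FourManifolds.LefschetzBase.rho g) q') (Λ (V 0)) (Λ (V 1)) (Λ (V 2)) :=
  fun _ _ _ Λ κ T V hq hq' hflat hflat' hw hw' hΛ hρ hκ hn hL hT0 hT hV hpos =>
    det4_sign_of_pageMap hq hq' hflat hflat' hw hw' Λ hΛ hρ κ hκ hn hL T hT0 hT V hV hpos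

end Summit.SmoothPoincare4.SmoothPoincare4.Theorems.AcyclicBisectionExists.ModpBraidOrbits

end
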